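import Summits.Schanuel.Schanuel.Theorems.SoloInformedMixedAPAnalytic
import Summits.Schanuel.Schanuel.Theorems.SoloInformedMultiplicityClasses

/-!
# Mixed AP-integrality charged to one multiplicity class

Solo-informed Schanuel seat, session s191 (2026-08-31); fourth file (K4a) of the seat's kernel
plan for the MIXED Lemma AE₃ (`work/s188/MIXED-AE3-note.md` §2 (f), §6).

Setting: `Q ≠ 0` in `ℤ[X]` with DISTINCT complex roots listed injectively by
`ρ : Fin D → ℂ`, and an integer polynomial `F ≠ 0` vanishing at all of them (e.g. the radical);
`T` a set of index triples `q = (i, j, k)` with `ρ i + ρ k − 2 ρ j ≠ 0` whose root in one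
fixed slot (`i`, `j` or `k`) has multiplicity `≥ e` in `Q` (`e ≥ 1`).  Then

  `e · ∑_{q ∈ T} log (1 / ‖ρ i + ρ k − 2 ρ j‖)
      ≤ (deg F)² log M(Q) + 2 (deg Q)(deg F) log M(F) + (deg Q)(deg F)² log 4`

(`soloMK_class_budget_fst / _mid / _snd` for the three slots).  Proof: the class polynomial
`F_e` of `SoloInformedMultiplicityClasses` (`F_e ^ e ∣ Q`, `e deg F_e ≤ deg Q`,
`e log M(F_e) ≤ log M(Q)`, the multiplicity-`≥ e` roots among its roots) in the distinguished
slot and `F` in the other two, fed to the three-polynomial AP-integrality inequality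
`soloMA_sum_log_le` (`SoloInformedMixedAPAnalytic`) through the injection "value triple ↦ some
index triple" (`soloMK_sum_log_le_of_values`), then the arithmetic `soloMK_class_arith`.

This is the per-class charge of the seat's mixed budget: summed over the dyadic classes
`e = 2^j ≤ deg Q` and the three slots it replaces the one-polynomial budget
`3 D² log M + D³ log 4` (cubic in `D = deg Q`) by a bound quadratic in `deg F`.

## Why (seat bookkeeping)

Toy layer only (node `RoyAdditiveDirichletExponent`, [cite: Roy2010, Thm 1.1]); nothing here
bears on `Literature.Periods.SchanuelConjecture`; the seat's verdict (no path) is unchanged.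
No novelty claimed; Mathlib + the seat files only; no definitions; no literature hypotheses;
standard axioms.
-/

namespace Summit.Schanuel.Schanuel.Theorems

open Finset Polynomial

section Core

variable {D₁ D₂ D₃ : ℕ}

/-- **Injection form of the three-polynomial AP inequality.**  `soloMA_sum_log_le` for a
family of VALUE triples `(a q, b q, d q)`, `q ∈ T`, injective in `q`, with `a q`, `b q`,
`d q` roots of `G₁`, `G₂`, `G₃` and `a q + d q − 2 b q ≠ 0`. -/
theorem soloMK_sum_log_le_of_values {α : Type*} (G₁ G₂ G₃ : ℤ[X]) (hG₁ : G₁ ≠ 0)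
    (hG₂ : G₂ ≠ 0) (hG₃ : G₃ ≠ 0) (hD₁ : G₁.natDegree = D₁) (hD₂ : G₂.natDegree = D₂)
    (hD₃ : G₃.natDegree = D₃) (ρ₁ : Fin D₁ → ℂ) (ρ₂ : Fin D₂ → ℂ) (ρ₃ : Fin D₃ → ℂ)
    (hρ₁ : univ.val.map ρ₁ = (G₁.map (Int.castRingHom ℂ)).roots)
    (hρ₂ : univ.val.map ρ₂ = (G₂.map (Int.castRingHom ℂ)).roots)
    (hρ₃ : univ.val.map ρ₃ = (G₃.map (Int.castRingHom ℂ)).roots) (T : Finset α)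
    (a b d : α → ℂ) (ha : ∀ q ∈ T, ∃ i, ρ₁ i = a q) (hb : ∀ q ∈ T, ∃ j, ρ₂ j = b q)
    (hd : ∀ q ∈ T, ∃ k, ρ₃ k = d q) (hinj : Set.InjOn (fun q => (a q, b q, d q)) T)
    (hne : ∀ q ∈ T, a q + d q - 2 * b q ≠ 0) :
    ∑ q ∈ T, Real.log (1 / ‖a q + d q - 2 * b q‖) ≤
      ((D₂ * D₃ : ℕ) : ℝ) * Real.log (G₁.map (Int.castRingHom ℂ)).mahlerMeasure
        + ((D₁ * D₃ : ℕ) : ℝ) * Real.log (G₂.map (Int.castRingHom ℂ)).mahlerMeasure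
        + ((D₁ * D₂ : ℕ) : ℝ) * Real.log (G₃.map (Int.castRingHom ℂ)).mahlerMeasure
        + ((D₁ * D₂ * D₃ : ℕ) : ℝ) * Real.log 4 := by
  classical
  set Φ : {q // q ∈ T} → Fin D₁ × Fin D₂ × Fin D₃ :=
    fun q => ((ha q.1 q.2).choose, (hb q.1 q.2).choose, (hd q.1 q.2).choose) with hΦ
  have hΦ₁ : ∀ q : {q // q ∈ T}, ρ₁ (Φ q).1 = a q.1 := fun q => (ha q.1 q.2).choose_spec
  have hΦ₂ : ∀ q : {q // q ∈ T}, ρ₂ (Φ q).2.1 = b q.1 := fun q => (hb q.1 q.2).choose_spec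
  have hΦ₃ : ∀ q : {q // q ∈ T}, ρ₃ (Φ q).2.2 = d q.1 := fun q => (hd q.1 q.2).choose_spec
  have hΦinj : Function.Injective Φ := by
    intro q q' h
    apply Subtype.ext
    apply hinj q.2 q'.2
    show (a q.1, b q.1, d q.1) = (a q'.1, b q'.1, d q'.1)
    rw [← hΦ₁ q, ← hΦ₁ q', ← hΦ₂ q, ← hΦ₂ q', ← hΦ₃ q, ← hΦ₃ q', h]
  set L : Fin D₁ × Fin D₂ × Fin D₃ → ℂ := fun t => ρ₁ t.1 + ρ₃ t.2.2 - 2 * ρ₂ t.2.1 with hL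
  have hT' : ∀ t ∈ (univ : Finset {q // q ∈ T}).image Φ, L t ≠ 0 := by
    intro t ht
    obtain ⟨q, -, rfl⟩ := Finset.mem_image.mp ht
    simp only [hL, hΦ₁, hΦ₂, hΦ₃]
    exact hne q.1 q.2
  have hcore := soloMA_sum_log_le G₁ G₂ G₃ hG₁ hG₂ hG₃ hD₁ hD₂ hD₃ ρ₁ ρ₂ ρ₃ hρ₁ hρ₂ hρ₃ L
    (fun _ => rfl) _ hT'
  have hsum : ∑ q ∈ T, Real.log (1 / ‖a q + d q - 2 * b q‖) =
      ∑ t ∈ (univ : Finset {q // q ∈ T}).image Φ, Real.log (1 / ‖L t‖) := by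
    rw [← Finset.sum_attach T, Finset.attach_eq_univ,
      Finset.sum_image (fun q _ q' _ h => hΦinj h)]
    refine Finset.sum_congr rfl (fun q _ => ?_)
    simp only [hL, hΦ₁, hΦ₂, hΦ₃]
  rw [hsum]
  exact hcore

/-- The arithmetic of one class: `e ≥ 0`, `e D_e ≤ N_Q`, `e L_e ≤ L_Q` give
`e (D_F² L_e + 2 D_e D_F L_F + D_e D_F² log 4) ≤ D_F² L_Q + 2 N_Q D_F L_F + N_Q D_F² log 4`. -/
theorem soloMK_class_arith {x De DF NQ LQ LF Le l4 : ℝ} (hDF : 0 ≤ DF) (hLF : 0 ≤ LF)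
    (hl4 : 0 ≤ l4) (hdeg : x * De ≤ NQ) (hM : x * Le ≤ LQ) :
    x * (DF * DF * Le + 2 * (De * DF * LF) + De * DF * DF * l4) ≤
      DF ^ 2 * LQ + 2 * NQ * DF * LF + NQ * DF ^ 2 * l4 := by
  have f1 := mul_le_mul_of_nonneg_left hM (mul_nonneg hDF hDF)
  have f2 := mul_le_mul_of_nonneg_left hdeg (mul_nonneg hDF hLF)
  have f3 := mul_le_mul_of_nonneg_left hdeg (mul_nonneg (mul_nonneg hDF hDF) hl4)
  nlinarith [f1, f2, f3]

end Core

section Slots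

variable {D : ℕ}

/-- **Class budget, first slot.**  Distinct roots `ρ` of `Q ≠ 0`, `F ≠ 0` vanishing at all of
them, `T` a set of index triples with non-degenerate progression defect whose FIRST root has
multiplicity `≥ e ≥ 1`:
`e ∑_T log(1/‖ρ i + ρ k − 2ρ j‖) ≤ D_F² log M(Q) + 2 N_Q D_F log M(F) + N_Q D_F² log 4`. -/
theorem soloMK_class_budget_fst (Q F : ℤ[X]) (hQ : Q ≠ 0) (hF : F ≠ 0) (ρ : Fin D → ℂ)
    (hρ : Function.Injective ρ) (hρF : ∀ k, aeval (ρ k) F = 0) {e : ℕ} (he : 1 ≤ e)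
    (T : Finset (Fin D × Fin D × Fin D)) (hT : ∀ q ∈ T, ρ q.1 + ρ q.2.2 - 2 * ρ q.2.1 ≠ 0)
    (hTe : ∀ q ∈ T, e ≤ rootMultiplicity (ρ q.1) (Q.map (Int.castRingHom ℂ))) :
    (e : ℝ) * ∑ q ∈ T, Real.log (1 / ‖ρ q.1 + ρ q.2.2 - 2 * ρ q.2.1‖) ≤
      (F.natDegree : ℝ) ^ 2 * Real.log (Q.map (Int.castRingHom ℂ)).mahlerMeasure
        + 2 * Q.natDegree * F.natDegree * Real.log (F.map (Int.castRingHom ℂ)).mahlerMeasure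
        + Q.natDegree * (F.natDegree : ℝ) ^ 2 * Real.log 4 := by
  obtain ⟨Fe, hFe0, hdeg, hM, hroots⟩ := soloMC_exists_class_poly_real Q hQ he
  obtain ⟨ρe, hρe⟩ := soloSI_exists_roots_enum (L := ℂ) Fe
  obtain ⟨ρF, hρF'⟩ := soloSI_exists_roots_enum (L := ℂ) F
  have hsum := soloMK_sum_log_le_of_values Fe F F hFe0 hF hF rfl rfl rfl ρe ρF ρF hρe hρF'
    hρF' T (fun q => ρ q.1) (fun q => ρ q.2.1) (fun q => ρ q.2.2)
    (fun q hq => soloDG_exists_index_of_aeval_eq_zero Fe hFe0 ρe hρe (hroots _ (hTe q hq)))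
    (fun q _ => soloDG_exists_index_of_aeval_eq_zero F hF ρF hρF' (hρF _))
    (fun q _ => soloDG_exists_index_of_aeval_eq_zero F hF ρF hρF' (hρF _)) ?_ hT
  · have hLF : 0 ≤ Real.log (F.map (Int.castRingHom ℂ)).mahlerMeasure :=
      Real.log_nonneg (one_le_mahlerMeasure_of_ne_zero hF)
    have hl4 : 0 ≤ Real.log 4 := Real.log_nonneg (by norm_num)
    push_cast at hsum
    calc (e : ℝ) * ∑ q ∈ T, Real.log (1 / ‖ρ q.1 + ρ q.2.2 - 2 * ρ q.2.1‖)
        ≤ (e : ℝ) * ((F.natDegree : ℝ) * F.natDegree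
            * Real.log (Fe.map (Int.castRingHom ℂ)).mahlerMeasure
            + 2 * (Fe.natDegree * F.natDegree
              * Real.log (F.map (Int.castRingHom ℂ)).mahlerMeasure)
            + Fe.natDegree * F.natDegree * F.natDegree * Real.log 4) :=
          mul_le_mul_of_nonneg_left (by linarith) (Nat.cast_nonneg _)
      _ ≤ _ := soloMK_class_arith (Nat.cast_nonneg _) hLF hl4 hdeg hM
  · intro q hq q' hq' h
    simp only [Prod.mk.injEq] at h
    exact Prod.ext (hρ h.1) (Prod.ext (hρ h.2.1) (hρ h.2.2))

/-- **Class budget, middle slot** (the MIDPOINT root has multiplicity `≥ e`). -/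
theorem soloMK_class_budget_mid (Q F : ℤ[X]) (hQ : Q ≠ 0) (hF : F ≠ 0) (ρ : Fin D → ℂ)
    (hρ : Function.Injective ρ) (hρF : ∀ k, aeval (ρ k) F = 0) {e : ℕ} (he : 1 ≤ e)
    (T : Finset (Fin D × Fin D × Fin D)) (hT : ∀ q ∈ T, ρ q.1 + ρ q.2.2 - 2 * ρ q.2.1 ≠ 0)
    (hTe : ∀ q ∈ T, e ≤ rootMultiplicity (ρ q.2.1) (Q.map (Int.castRingHom ℂ))) :
    (e : ℝ) * ∑ q ∈ T, Real.log (1 / ‖ρ q.1 + ρ q.2.2 - 2 * ρ q.2.1‖) ≤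
      (F.natDegree : ℝ) ^ 2 * Real.log (Q.map (Int.castRingHom ℂ)).mahlerMeasure
        + 2 * Q.natDegree * F.natDegree * Real.log (F.map (Int.castRingHom ℂ)).mahlerMeasure
        + Q.natDegree * (F.natDegree : ℝ) ^ 2 * Real.log 4 := by
  obtain ⟨Fe, hFe0, hdeg, hM, hroots⟩ := soloMC_exists_class_poly_real Q hQ he
  obtain ⟨ρe, hρe⟩ := soloSI_exists_roots_enum (L := ℂ) Fe
  obtain ⟨ρF, hρF'⟩ := soloSI_exists_roots_enum (L := ℂ) F
  have hsum := soloMK_sum_log_le_of_values F Fe F hF hFe0 hF rfl rfl rfl ρF ρe ρF hρF' hρe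
    hρF' T (fun q => ρ q.1) (fun q => ρ q.2.1) (fun q => ρ q.2.2)
    (fun q _ => soloDG_exists_index_of_aeval_eq_zero F hF ρF hρF' (hρF _))
    (fun q hq => soloDG_exists_index_of_aeval_eq_zero Fe hFe0 ρe hρe (hroots _ (hTe q hq)))
    (fun q _ => soloDG_exists_index_of_aeval_eq_zero F hF ρF hρF' (hρF _)) ?_ hT
  · have hLF : 0 ≤ Real.log (F.map (Int.castRingHom ℂ)).mahlerMeasure :=
      Real.log_nonneg (one_le_mahlerMeasure_of_ne_zero hF)
    have hl4 : 0 ≤ Real.log 4 := Real.log_nonneg (by norm_num)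
    push_cast at hsum
    calc (e : ℝ) * ∑ q ∈ T, Real.log (1 / ‖ρ q.1 + ρ q.2.2 - 2 * ρ q.2.1‖)
        ≤ (e : ℝ) * ((F.natDegree : ℝ) * F.natDegree
            * Real.log (Fe.map (Int.castRingHom ℂ)).mahlerMeasure
            + 2 * (Fe.natDegree * F.natDegree
              * Real.log (F.map (Int.castRingHom ℂ)).mahlerMeasure)
            + Fe.natDegree * F.natDegree * F.natDegree * Real.log 4) :=
          mul_le_mul_of_nonneg_left (by linarith) (Nat.cast_nonneg _)
      _ ≤ _ := soloMK_class_arith (Nat.cast_nonneg _) hLF hl4 hdeg hM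
  · intro q hq q' hq' h
    simp only [Prod.mk.injEq] at h
    exact Prod.ext (hρ h.1) (Prod.ext (hρ h.2.1) (hρ h.2.2))

/-- **Class budget, last slot** (the LAST root has multiplicity `≥ e`). -/
theorem soloMK_class_budget_snd (Q F : ℤ[X]) (hQ : Q ≠ 0) (hF : F ≠ 0) (ρ : Fin D → ℂ)
    (hρ : Function.Injective ρ) (hρF : ∀ k, aeval (ρ k) F = 0) {e : ℕ} (he : 1 ≤ e)
    (T : Finset (Fin D × Fin D × Fin D)) (hT : ∀ q ∈ T, ρ q.1 + ρ q.2.2 - 2 * ρ q.2.1 ≠ 0)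
    (hTe : ∀ q ∈ T, e ≤ rootMultiplicity (ρ q.2.2) (Q.map (Int.castRingHom ℂ))) :
    (e : ℝ) * ∑ q ∈ T, Real.log (1 / ‖ρ q.1 + ρ q.2.2 - 2 * ρ q.2.1‖) ≤
      (F.natDegree : ℝ) ^ 2 * Real.log (Q.map (Int.castRingHom ℂ)).mahlerMeasure
        + 2 * Q.natDegree * F.natDegree * Real.log (F.map (Int.castRingHom ℂ)).mahlerMeasure
        + Q.natDegree * (F.natDegree : ℝ) ^ 2 * Real.log 4 := by
  obtain ⟨Fe, hFe0, hdeg, hM, hroots⟩ := soloMC_exists_class_poly_real Q hQ he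
  obtain ⟨ρe, hρe⟩ := soloSI_exists_roots_enum (L := ℂ) Fe
  obtain ⟨ρF, hρF'⟩ := soloSI_exists_roots_enum (L := ℂ) F
  have hsum := soloMK_sum_log_le_of_values F F Fe hF hF hFe0 rfl rfl rfl ρF ρF ρe hρF' hρF'
    hρe T (fun q => ρ q.1) (fun q => ρ q.2.1) (fun q => ρ q.2.2)
    (fun q _ => soloDG_exists_index_of_aeval_eq_zero F hF ρF hρF' (hρF _))
    (fun q _ => soloDG_exists_index_of_aeval_eq_zero F hF ρF hρF' (hρF _))
    (fun q hq => soloDG_exists_index_of_aeval_eq_zero Fe hFe0 ρe hρe (hroots _ (hTe q hq)))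
    ?_ hT
  · have hLF : 0 ≤ Real.log (F.map (Int.castRingHom ℂ)).mahlerMeasure :=
      Real.log_nonneg (one_le_mahlerMeasure_of_ne_zero hF)
    have hl4 : 0 ≤ Real.log 4 := Real.log_nonneg (by norm_num)
    push_cast at hsum
    calc (e : ℝ) * ∑ q ∈ T, Real.log (1 / ‖ρ q.1 + ρ q.2.2 - 2 * ρ q.2.1‖)
        ≤ (e : ℝ) * ((F.natDegree : ℝ) * F.natDegree
            * Real.log (Fe.map (Int.castRingHom ℂ)).mahlerMeasure
            + 2 * (Fe.natDegree * F.natDegree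
              * Real.log (F.map (Int.castRingHom ℂ)).mahlerMeasure)
            + Fe.natDegree * F.natDegree * F.natDegree * Real.log 4) :=
          mul_le_mul_of_nonneg_left (by linarith) (Nat.cast_nonneg _)
      _ ≤ _ := soloMK_class_arith (Nat.cast_nonneg _) hLF hl4 hdeg hM
  · intro q hq q' hq' h
    simp only [Prod.mk.injEq] at h
    exact Prod.ext (hρ h.1) (Prod.ext (hρ h.2.1) (hρ h.2.2))

end Slots

end Summit.Schanuel.Schanuel.Theorems
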